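import Literature.NumberTheory.GaloisRepresentations.LocalGlobalCohomologyFiniteProofs
import HarnessLib

/-!
# Finite-index subgroups of `K^×` are open, `K` a non-archimedean local field of characteristic `0`
# (theorems only)

Topic `NumberTheory/GaloisRepresentations` (local fields); namespace
`Literature.NumberTheory.GaloisRepresentations`.  No definitions, no named facts.

For a non-archimedean local field `K` (Mathlib `IsNonarchimedeanLocalField`, valued form) and
`n ≠ 0` in `K`:

* `isOpen_range_powMonoidHom_units` — **`(K^×)^n` is an open subgroup of `K^×`**: it contains the
  neighbourhood `{x : v(x - 1) < v(n²)}` of `1`, every element of which is `1 + n² w` with `w ∈ 𝔪`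
  and hence an `n`-th power of a unit by Hensel's lemma (tree
  `exists_units_pow_eq_one_add`, `henselianLocalRing_integer`).
* `Subgroup.isOpen_of_finiteIndex_units_localField` — in characteristic `0`, **every subgroup of
  finite index `m` of `K^×` is open** (it contains `(K^×)^m`).

These are the standard consequences of the structure `K^× ≅ ℤ ⊕ ℤ/(q-1) ⊕ ℤ/p^a ⊕ ℤ_p^d`
(Neukirch, *Algebraic Number Theory*, Ch. II Prop. (5.7); Serre, *Local Fields*, Ch. XIV §6,
discussion after Cor. 1: in characteristic `0` "every subgroup of finite index of `K^*` is open"),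
proved here without the structure theorem.  Used by the abc-iut cell (layer L4, LCFT inputs of
[AbsAnab] §1.2: profinite completion of `K^×` versus `G_K^{ab}`).
-/

noncomputable section

open scoped Topology
open ValuativeRel

universe u

namespace Literature.NumberTheory.GaloisRepresentations

variable (K : Type u) [Field K] [ValuativeRel K] [TopologicalSpace K] [IsNonarchimedeanLocalField K]

/-- **`(K^×)^n` is open in `K^×`** for a non-archimedean local field `K` with `n ≠ 0` in `K`: the
neighbourhood `{x : v(x - 1) < v(n²)}` of `1` consists of `n`-th powers (`x = 1 + n² w`, `w ∈ 𝔪`,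
is `u^n` for a unit `u` by Hensel's lemma).  Corollary of Neukirch, *ANT* II (5.7) (there via
`U^{(m)} ≅ ℤ_p^d`). [cite: NeukirchANT1999, Ch. II Prop. (5.7)] -/
theorem isOpen_range_powMonoidHom_units {n : ℕ} (hn : (n : K) ≠ 0) :
    IsOpen ((powMonoidHom n : Kˣ →* Kˣ).range : Set Kˣ) := by
  letI : UniformSpace K := IsTopologicalAddGroup.rightUniformSpace K
  haveI : IsUniformAddGroup K := isUniformAddGroup_of_addCommGroup
  haveI := henselianLocalRing_integer K
  apply Subgroup.isOpen_of_mem_nhds _ (g := 1)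
  -- the neighbourhood `{x : v (x - 1) < v (n ^ 2)}` of `1 : Kˣ`
  have hn2 : valuation K ((n : K) ^ 2) ≠ 0 := by
    rw [Ne, map_eq_zero]
    exact pow_ne_zero 2 hn
  set γ : (ValueGroupWithZero K)ˣ := Units.mk0 _ hn2 with hγ
  have hS : {z : K | valuation K (z - 1) < γ} ∈ 𝓝 (1 : K) :=
    (IsValuativeTopology.mem_nhds_iff' (s := {z : K | valuation K (z - 1) < γ}) (x := (1 : K))).2
      ⟨γ, subset_rfl⟩
  have hT : (Units.val ⁻¹' {z : K | valuation K (z - 1) < γ}) ∈ 𝓝 (1 : Kˣ) := by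
    rw [Units.isEmbedding_val₀.nhds_eq_comap, Units.val_one]
    exact Filter.preimage_mem_comap hS
  refine Filter.mem_of_superset hT fun x hx => ?_
  simp only [Set.mem_preimage, Set.mem_setOf_eq, hγ, Units.val_mk0] at hx
  -- `x - 1 = n² w` with `w ∈ 𝔪`
  have hn2' : ((n : K) ^ 2) ≠ 0 := pow_ne_zero 2 hn
  set w : K := ((x : K) - 1) / (n : K) ^ 2 with hw
  have hwv : valuation K w < 1 := by
    rw [hw, map_div₀, div_lt_one₀ (lt_of_le_of_ne zero_le hn2.symm)]
    exact hx
  have hwO : w ∈ 𝒪[K] := (Valuation.mem_integer_iff _ _).2 hwv.le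
  have hwm : (⟨w, hwO⟩ : 𝒪[K]) ∈ IsLocalRing.maximalIdeal 𝒪[K] := by
    rw [IsLocalRing.mem_maximalIdeal, mem_nonunits_iff]
    exact (Valuation.Integer.not_isUnit_iff_valuation_lt_one (x := (⟨w, hwO⟩ : 𝒪[K]))).2 hwv
  obtain ⟨u, hu, -⟩ := exists_units_pow_eq_one_add (R := 𝒪[K]) n hwm
  -- `x = u ^ n` in `Kˣ`
  refine ⟨Units.map ((𝒪[K]).subtype : 𝒪[K] →* K) u, Units.ext ?_⟩
  have hu' : (((u : 𝒪[K]) : K)) ^ n = 1 + (n : K) ^ 2 * w := by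
    have := congrArg (Subtype.val : 𝒪[K] → K) hu
    simpa using this
  rw [powMonoidHom_apply, Units.val_pow_eq_pow_val, Units.coe_map, MonoidHom.coe_coe,
    Subring.subtype_apply, hu', hw, mul_div_cancel₀ _ hn2', add_sub_cancel]

/-- **In characteristic `0`, every finite-index subgroup of `K^×` is open** (`K` a non-archimedean
local field): a subgroup of index `m` contains `(K^×)^m`, which is open
(`isOpen_range_powMonoidHom_units`).  Serre, *Local Fields*, Ch. XIV §6 (after Cor. 1);
corollary of Neukirch, *ANT* II (5.7). [cite: NeukirchANT1999, Ch. II Prop. (5.7)] -/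
theorem Subgroup.isOpen_of_finiteIndex_units_localField [CharZero K] (N : Subgroup Kˣ)
    [N.FiniteIndex] : IsOpen (N : Set Kˣ) := by
  have hm : (N.index : K) ≠ 0 := Nat.cast_ne_zero.2 Subgroup.FiniteIndex.index_ne_zero
  refine Subgroup.isOpen_mono ?_ (isOpen_range_powMonoidHom_units K hm)
  rintro _ ⟨x, rfl⟩
  rw [powMonoidHom_apply]
  exact Subgroup.pow_index_mem N x

end Literature.NumberTheory.GaloisRepresentations
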